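import Summits.HodgeConjecture.CorCM.Census.OddSliceFacesModel

/-!
# The dicyclic twist `Dic(A) ⊃ ℤ/2 × A`, I: the model — pairs of odd-slice labels, the two motions, marginals, the Hodge lattice, pairs

COR-CM (cell `pub-hodgecm2`, stage 2 of the Hodge ladder), count-neutral KERNEL COMBINATORICS by the binder seat b23 (gen 42; claim
DICYCLIC-COLUMN, HOME/INBOX.md l.10328): part I of the lane `DicyclicTwistModel` → `DicyclicTwistFaces` → `DicyclicTwistSquares` →
`DicyclicTwistFunctionals` → `DicyclicTwistResidual` → `DicyclicTwistGenerate` → `DicyclicTwistCount`.  Bookkeeping definitions with bodies +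
theorems on top of seat b09's representative-free odd slice `Census/OddSliceFacesModel.lean` (`Ty A`, `tw`, `transl`, `coef`, `hodge`, `pairVec`,
`δ`), used BY NAME; no `decide` table, no certificate, no named fact, no geometry, no `sorry`.  `Interfaces.lean` (C1), every E term, B01,
`Transposition/*`, `PortJoin/*` untouched.
HONEST FRAMING: `HC_CM` is NOT proved, here or anywhere in the tree; nothing here is a period, a count of record or a headline.

THE MODEL.  `A` is a finite abelian group (of odd order `≥ 3` in the later parts), `H = ℤ/2 × A` with `c = (1,0)`, and
`G = Dic(A) = ⟨H, x | x h x⁻¹ = h⁻¹ (h ∈ H), x² = c⟩` the GENERALISED DICYCLIC GROUP over `A` (`Dic(ℤ/m) = Dic_m`, the dicyclic group of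
order `4m`: the Galois groups of the dicyclic CM fields of degree `4m` of seat lit-andre-3's atlases `Census/{Dodecic,Icosic}Dicyclic*`; `c = x²`
is their unique central involution and is NOT complemented, so these groups lie in the twisted column of the census).  By the index-two
descent of `Census/IndexTwoDescent{Dictionary,Hodge,Blocks,Inversion}.lean` (this seat, gen 41) an abstract CM type of `(G, c)` is a PAIR
`Ψ = (ψ₀, ψ₁)` of CM types of `(H, c)` — in b09's labelling two maps `A → ℤ/2` (`Ty₂ A = Ty A × Ty A`, §1) —, on which `h = (a, t) ∈ H`
acts DIAGONALLY by b09's twist (`twH`) and `x` by the SWAP-TWIST **`twX (ψ₀, ψ₁) = (ψ₁(−·), ψ₀(−·) + 1)`** (`conjPull = invType` and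
`pushTwist = invType ∘ (·c)` of part VI of the descent, `x` inverting the abelian group `H`); **`twX ∘ twX = twH c`** and
**`twX ∘ twH (a,t) = twH (a,−t) ∘ twX`** (§1, `twX_twX`, `twX_twH`) are the defining relations of `Dic(A)`, so the translates `translH g`,
`translX` of exponent vectors (§1) generate the action of `ℤ[G]` on `ℤ[Ty₂ A]`.  A vector is HODGE iff both MARGINALS
`marg₀ v = Σ_{ψ₁} v(·, ψ₁)`, `marg₁ v = Σ_{ψ₀} v(ψ₀, ·)` lie in b09's `hodge A` (`hodge₂`, §2 — `Census/IndexTwoDescentHodge.mem_hodgeSpan_iff_marg`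
read in the model: the Pohlmann form of `h ∈ H` resp. `xh ∈ xH` on `Ψ` is the form of `h` on `ψ₀` resp. `ψ₁`); the divisor classes are
`e_Ψ + e_{Ψ̄}`, `Ψ̄ = (ψ₀ + 1, ψ₁ + 1) = twH c Ψ` (`pairVec₂`, `pairs₂ ≤ hodge₂`).  §3: the marginals of translates (`marg₀_translH`, …,
`marg₀_translX v = (marg₁ v) ∘ rev`, `marg₁_translX v = (c·marg₀ v) ∘ rev`), whence **`hodge₂` is stable under both motions** (`translH_mem`,
`translX_mem`; b09's `hodge A` is stable under reversal, `revT_mem_hodge`).  Part II (`DicyclicTwistFaces`) adds the three kinds of rank-four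
faces (coordinate faces in either coset, mixed faces) and their motions.
THE LAW this lane heads for (parts III–VII; design note `HOME/pub-hodgecm2-b23/DICYCLIC-COLUMN.md`, numerically certified for `A = ℤ/3, ℤ/5`
at the primes `2, 3, 5, 7, 10007`): for `|A|` odd `≥ 3`, `β(G) − 1` face classes — one potential-reducing face per block off the three
residual blocks and two equator-crossing coordinate squares `(0 | 𝟙_P; u, u′)`, `(0 | 𝟙_{P ∪ u}; u′, u″)`, `|P| = (|A| − 3)/2` — generate
`hodge₂` modulo `pairs₂` together with their `G`-translates (`μ(Dic(A)) ≤ β − 1`, the value of lit-andre-3's kernel atlases `μ(Dic₃) = 5`,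
`μ(Dic₅) = 51`).  All [folklore].

## References
* [Pohlmann1968] H. Pohlmann, Algebraic cycles on abelian varieties of complex multiplication type, Ann. of Math. 88 (1968), Thm 1.
* [Milne1999] J. S. Milne, Lefschetz motives and the Tate conjecture, Compositio Math. 117 (1999), Prop. 2.1, p. 54.
-/

namespace Summit.HodgeConjecture.CorCM.Census.DicyclicTwist

open Finset
open Summit.HodgeConjecture.CorCM.Census.OddSliceFacesModel

/-! ## §1 Labels and the two motions -/

section Labels

variable (A : Type) [AddCommGroup A] [DecidableEq A]

/-- The labels of `(Dic(A), c)`: pairs of odd-slice labels `(ψ₀, ψ₁)`, `ψ_e : A → ℤ/2`. [folklore] -/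
abbrev Ty₂ : Type := Ty A × Ty A

/-- Reversal of a label: `(rev ψ)(s) = ψ(−s)` (conjugation by `x` inverts `A`). [folklore] -/
def rev (ψ : Ty A) : Ty A := fun s => ψ (-s)

omit [DecidableEq A] in
/-- `rev` is an involution. [folklore] -/
@[simp] theorem rev_rev (ψ : Ty A) : rev A (rev A ψ) = ψ := by
  funext s; simp [rev]

omit [DecidableEq A] in
/-- `rev` commutes with conjugation. [folklore] -/
theorem rev_add_one (ψ : Ty A) : rev A (ψ + 1) = rev A ψ + 1 := by
  funext s; simp [rev]

omit [DecidableEq A] in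
/-- `rev` is additive. [folklore] -/
theorem rev_add (ψ χ : Ty A) : rev A (ψ + χ) = rev A ψ + rev A χ := by
  funext s; simp [rev]

/-- `rev (δ i) = δ (−i)`. [folklore] -/
theorem rev_delta (i : A) : rev A (δ A i) = δ A (-i) := by
  funext s
  simp only [rev, delta_apply]
  by_cases h : s = -i
  · rw [if_pos h, if_pos (by rw [h, neg_neg])]
  · rw [if_neg h, if_neg (fun h' => h (by rw [← h', neg_neg]))]

/-- `rev (φ + δ i) = rev φ + δ (−i)`. [folklore] -/
theorem rev_add_delta (φ : Ty A) (i : A) : rev A (φ + δ A i) = rev A φ + δ A (-i) := by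
  rw [rev_add, rev_delta]

omit [DecidableEq A] in
/-- `rev` conjugates the twist by `(a, t)` into the twist by `(a, −t)`. [folklore] -/
theorem rev_tw (g : ZMod 2 × A) (ψ : Ty A) : rev A (tw A g ψ) = tw A (g.1, -g.2) (rev A ψ) := by
  funext s
  simp only [rev, tw, neg_add, neg_neg]

/-- **The diagonal motion** of `h = (a, t) ∈ H`: `twH h (ψ₀, ψ₁) = (tw h ψ₀, tw h ψ₁)`. [folklore] -/
def twH (g : ZMod 2 × A) (Ψ : Ty₂ A) : Ty₂ A := (tw A g Ψ.1, tw A g Ψ.2)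

/-- **The swap-twist** of `x`: `twX (ψ₀, ψ₁) = (rev ψ₁, rev ψ₀ + 1)`. [folklore] -/
def twX (Ψ : Ty₂ A) : Ty₂ A := (rev A Ψ.2, rev A Ψ.1 + 1)

/-- The inverse swap-twist (of `x⁻¹`): `twXinv (ψ₀, ψ₁) = (rev ψ₁ + 1, rev ψ₀)`. [folklore] -/
def twXinv (Ψ : Ty₂ A) : Ty₂ A := (rev A Ψ.2 + 1, rev A Ψ.1)

omit [DecidableEq A] in
/-- Composition of diagonal motions. [folklore] -/
theorem twH_twH (g h : ZMod 2 × A) (Ψ : Ty₂ A) : twH A g (twH A h Ψ) = twH A (h + g) Ψ := by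
  simp only [twH, tw_tw]

omit [DecidableEq A] in
/-- The diagonal motion by `0` is the identity. [folklore] -/
@[simp] theorem twH_zero (Ψ : Ty₂ A) : twH A 0 Ψ = Ψ := by
  simp only [twH, tw_zero]

omit [DecidableEq A] in
/-- The diagonal motion by `c = (1,0)` is conjugation `(ψ₀ + 1, ψ₁ + 1)`. [folklore] -/
theorem twH_one_zero (Ψ : Ty₂ A) : twH A (1, 0) Ψ = (Ψ.1 + 1, Ψ.2 + 1) := by
  simp only [twH, tw_one_zero]

omit [DecidableEq A] in
/-- `x⁻¹ x = 1` on labels. [folklore] -/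
@[simp] theorem twXinv_twX (Ψ : Ty₂ A) : twXinv A (twX A Ψ) = Ψ := by
  obtain ⟨ψ₀, ψ₁⟩ := Ψ
  simp only [twX, twXinv, rev_add_one, rev_rev, add_one_add_one]

omit [DecidableEq A] in
/-- `x x⁻¹ = 1` on labels. [folklore] -/
@[simp] theorem twX_twXinv (Ψ : Ty₂ A) : twX A (twXinv A Ψ) = Ψ := by
  obtain ⟨ψ₀, ψ₁⟩ := Ψ
  simp only [twX, twXinv, rev_add_one, rev_rev, add_one_add_one]

omit [DecidableEq A] in
/-- **`x² = c`**: `twX ∘ twX` is conjugation. [folklore] -/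
theorem twX_twX (Ψ : Ty₂ A) : twX A (twX A Ψ) = twH A (1, 0) Ψ := by
  obtain ⟨ψ₀, ψ₁⟩ := Ψ
  simp only [twX, twH, rev_add_one, rev_rev, tw_one_zero]

omit [DecidableEq A] in
/-- **`x h = h⁻ˣ x`**: `twX ∘ twH (a,t) = twH (a,−t) ∘ twX`. [folklore] -/
theorem twX_twH (g : ZMod 2 × A) (Ψ : Ty₂ A) : twX A (twH A g Ψ) = twH A (g.1, -g.2) (twX A Ψ) := by
  obtain ⟨ψ₀, ψ₁⟩ := Ψ
  simp only [twX, twH, rev_tw, tw_add_one]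

/-- The diagonal motion as a permutation of the labels. [folklore] -/
def twHEquiv (g : ZMod 2 × A) : Ty₂ A ≃ Ty₂ A where
  toFun := twH A g
  invFun := twH A (-g)
  left_inv Ψ := by rw [twH_twH, add_neg_cancel, twH_zero]
  right_inv Ψ := by rw [twH_twH, neg_add_cancel, twH_zero]

/-- The swap-twist as a permutation of the labels. [folklore] -/
def twXEquiv : Ty₂ A ≃ Ty₂ A where
  toFun := twX A
  invFun := twXinv A
  left_inv := twXinv_twX A
  right_inv := twX_twXinv A

/-- Translate of an exponent vector by `h ∈ H`: `(h·v)(Ψ) = v(h⁻¹ Ψ)`. [folklore] -/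
def translH (g : ZMod 2 × A) (v : Ty₂ A → ℤ) : Ty₂ A → ℤ := fun Ψ => v (twH A (-g) Ψ)

/-- Translate of an exponent vector by `x`: `(x·v)(Ψ) = v(x⁻¹ Ψ)`. [folklore] -/
def translX (v : Ty₂ A → ℤ) : Ty₂ A → ℤ := fun Ψ => v (twXinv A Ψ)

/-- Translation by `h` as a `ℤ`-linear map. [folklore] -/
def translHHom (g : ZMod 2 × A) : (Ty₂ A → ℤ) →ₗ[ℤ] (Ty₂ A → ℤ) where
  toFun := translH A g
  map_add' _ _ := rfl
  map_smul' _ _ := rfl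

/-- Translation by `x` as a `ℤ`-linear map. [folklore] -/
def translXHom : (Ty₂ A → ℤ) →ₗ[ℤ] (Ty₂ A → ℤ) where
  toFun := translX A
  map_add' _ _ := rfl
  map_smul' _ _ := rfl

omit [DecidableEq A] in
/-- `translHHom` is `translH`. [folklore] -/
@[simp] theorem translHHom_apply (g : ZMod 2 × A) (v : Ty₂ A → ℤ) : translHHom A g v = translH A g v := rfl

omit [DecidableEq A] in
/-- `translXHom` is `translX`. [folklore] -/
@[simp] theorem translXHom_apply (v : Ty₂ A → ℤ) : translXHom A v = translX A v := rfl

end Labels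

/-! ## §2 Marginals, the Hodge lattice, pairs -/

section Lattice

variable (A : Type) [AddCommGroup A] [Fintype A] [DecidableEq A]

/-- **The `0`-marginal** `(marg₀ v)(ψ₀) = Σ_{ψ₁} v(ψ₀, ψ₁)`. [folklore] -/
def marg₀ : (Ty₂ A → ℤ) →ₗ[ℤ] (Ty A → ℤ) where
  toFun v := fun ψ₀ => ∑ ψ₁ : Ty A, v (ψ₀, ψ₁)
  map_add' v w := by funext ψ₀; simp [Finset.sum_add_distrib]
  map_smul' c v := by funext ψ₀; simp [Finset.mul_sum]

/-- **The `1`-marginal** `(marg₁ v)(ψ₁) = Σ_{ψ₀} v(ψ₀, ψ₁)`. [folklore] -/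
def marg₁ : (Ty₂ A → ℤ) →ₗ[ℤ] (Ty A → ℤ) where
  toFun v := fun ψ₁ => ∑ ψ₀ : Ty A, v (ψ₀, ψ₁)
  map_add' v w := by funext ψ₁; simp [Finset.sum_add_distrib]
  map_smul' c v := by funext ψ₁; simp [Finset.mul_sum]

omit [AddCommGroup A] in
/-- `marg₀` pointwise. [folklore] -/
theorem marg₀_apply (v : Ty₂ A → ℤ) (ψ₀ : Ty A) : marg₀ A v ψ₀ = ∑ ψ₁ : Ty A, v (ψ₀, ψ₁) := rfl

omit [AddCommGroup A] in
/-- `marg₁` pointwise. [folklore] -/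
theorem marg₁_apply (v : Ty₂ A → ℤ) (ψ₁ : Ty A) : marg₁ A v ψ₁ = ∑ ψ₀ : Ty A, v (ψ₀, ψ₁) := rfl

omit [AddCommGroup A] in
/-- `marg₀ (c·e_Ψ) = c·e_{ψ₀}`. [folklore] -/
@[simp] theorem marg₀_single (Ψ : Ty₂ A) (c : ℤ) : marg₀ A (Pi.single Ψ c) = Pi.single Ψ.1 c := by
  obtain ⟨α, β⟩ := Ψ
  funext ψ₀
  rw [marg₀_apply, Pi.single_apply]
  by_cases h : ψ₀ = α
  · subst h
    rw [if_pos rfl, Finset.sum_eq_single β]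
    · simp
    · intro ψ₁ _ hne
      simp [hne]
    · intro hβ; exact absurd (Finset.mem_univ β) hβ
  · rw [if_neg h]
    refine Finset.sum_eq_zero fun ψ₁ _ => ?_
    have hne : (ψ₀, ψ₁) ≠ (α, β) := fun e => h (Prod.mk.inj e).1
    simp [hne]

omit [AddCommGroup A] in
/-- `marg₁ (c·e_Ψ) = c·e_{ψ₁}`. [folklore] -/
@[simp] theorem marg₁_single (Ψ : Ty₂ A) (c : ℤ) : marg₁ A (Pi.single Ψ c) = Pi.single Ψ.2 c := by
  obtain ⟨α, β⟩ := Ψ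
  funext ψ₁
  rw [marg₁_apply, Pi.single_apply]
  by_cases h : ψ₁ = β
  · subst h
    rw [if_pos rfl, Finset.sum_eq_single α]
    · simp
    · intro ψ₀ _ hne
      simp [hne]
    · intro hα; exact absurd (Finset.mem_univ α) hα
  · rw [if_neg h]
    refine Finset.sum_eq_zero fun ψ₀ _ => ?_
    have hne : (ψ₀, ψ₁) ≠ (α, β) := fun e => h (Prod.mk.inj e).2
    simp [hne]

omit [DecidableEq A] in
/-- Translate of a unit vector by `h`. [folklore] -/
theorem translH_single (g : ZMod 2 × A) (Ψ : Ty₂ A) (c : ℤ) :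
    translH A g (Pi.single Ψ c) = Pi.single (twH A g Ψ) c := by
  funext Φ
  have hiff : twH A (-g) Φ = Ψ ↔ Φ = twH A g Ψ := by
    constructor
    · intro h; rw [← h, twH_twH, neg_add_cancel, twH_zero]
    · intro h; rw [h, twH_twH, add_neg_cancel, twH_zero]
  simp only [translH, Pi.single_apply, hiff]

omit [DecidableEq A] in
/-- Translate of a unit vector by `x`. [folklore] -/
theorem translX_single (Ψ : Ty₂ A) (c : ℤ) : translX A (Pi.single Ψ c) = Pi.single (twX A Ψ) c := by
  funext Φ
  have hiff : twXinv A Φ = Ψ ↔ Φ = twX A Ψ := by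
    constructor
    · intro h; rw [← h, twX_twXinv]
    · intro h; rw [h, twXinv_twX]
  simp only [translX, Pi.single_apply, hiff]

/-- **The Hodge lattice of `(Dic(A), c)`**: exponent vectors both of whose marginals are Hodge vectors of the odd slice
(`Census/IndexTwoDescentHodge.mem_hodgeSpan_iff_marg` in the model). [cite: Pohlmann1968, Thm 1] -/
def hodge₂ : Submodule ℤ (Ty₂ A → ℤ) := (hodge A).comap (marg₀ A) ⊓ (hodge A).comap (marg₁ A)

omit [AddCommGroup A] in
/-- Membership in `hodge₂`. [folklore] -/
theorem mem_hodge₂_iff (v : Ty₂ A → ℤ) : v ∈ hodge₂ A ↔ marg₀ A v ∈ hodge A ∧ marg₁ A v ∈ hodge A := Iff.rfl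

/-- Conjugation of a label: `Ψ̄ = (ψ₀ + 1, ψ₁ + 1)` (`= twH c Ψ`). [folklore] -/
def conj (Ψ : Ty₂ A) : Ty₂ A := (Ψ.1 + 1, Ψ.2 + 1)

omit [Fintype A] [DecidableEq A] in
/-- Conjugation is the diagonal motion by `c`. [folklore] -/
theorem conj_eq_twH (Ψ : Ty₂ A) : conj A Ψ = twH A (1, 0) Ψ := by
  rw [twH_one_zero]; rfl

/-- The conjugate (divisor) pair through `Ψ`: `e_Ψ + e_{Ψ̄}`. [folklore] -/
def pairVec₂ (Ψ : Ty₂ A) : Ty₂ A → ℤ := Pi.single Ψ 1 + Pi.single (conj A Ψ) 1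

/-- The divisor sublattice `P₂ = ℤ⟨pairs⟩`. [folklore] -/
def pairs₂ : Submodule ℤ (Ty₂ A → ℤ) := Submodule.span ℤ (Set.range (pairVec₂ A))

omit [AddCommGroup A] in
/-- The `0`-marginal of a pair is a pair. [folklore] -/
theorem marg₀_pairVec₂ (Ψ : Ty₂ A) : marg₀ A (pairVec₂ A Ψ) = pairVec A Ψ.1 := by
  rw [pairVec₂, map_add, marg₀_single, marg₀_single]; rfl

omit [AddCommGroup A] in
/-- The `1`-marginal of a pair is a pair. [folklore] -/
theorem marg₁_pairVec₂ (Ψ : Ty₂ A) : marg₁ A (pairVec₂ A Ψ) = pairVec A Ψ.2 := by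
  rw [pairVec₂, map_add, marg₁_single, marg₁_single]; rfl

omit [AddCommGroup A] in
/-- **The pairs are Hodge vectors.** [folklore] -/
theorem pairVec₂_mem (Ψ : Ty₂ A) : pairVec₂ A Ψ ∈ hodge₂ A := by
  rw [mem_hodge₂_iff, marg₀_pairVec₂, marg₁_pairVec₂]
  exact ⟨pairVec_mem A _, pairVec_mem A _⟩

omit [AddCommGroup A] in
/-- `P₂ ≤ H₂`. [folklore] -/
theorem pairs₂_le_hodge₂ : pairs₂ A ≤ hodge₂ A := by
  refine Submodule.span_le.mpr ?_
  rintro _ ⟨Ψ, rfl⟩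
  exact pairVec₂_mem A Ψ

/-! ## §3 The motions preserve the Hodge lattice -/

/-- Transport of an odd-slice exponent vector along `rev`: `(revT w)(ψ) = w(rev ψ)`. [folklore] -/
def revT (w : Ty A → ℤ) : Ty A → ℤ := fun ψ => w (rev A ψ)

/-- `rev` as a permutation of the odd-slice labels. [folklore] -/
def revEquiv : Ty A ≃ Ty A where
  toFun := rev A
  invFun := rev A
  left_inv := rev_rev A
  right_inv := rev_rev A

omit [Fintype A] [DecidableEq A] in
/-- The Pohlmann coefficient of `(a, t)` at a reversed label is the coefficient of `(a, −t)`. [folklore] -/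
theorem coef_rev (g : ZMod 2 × A) (ψ : Ty A) : coef A g (rev A ψ) = coef A (g.1, -g.2) ψ := by
  obtain ⟨a, t⟩ := g
  rfl

/-- **`hodge A` is stable under reversal.** [folklore] -/
theorem revT_mem {w : Ty A → ℤ} (hw : w ∈ hodge A) (g : ZMod 2 × A) : coef A g ⬝ᵥ revT A w = 0 := by
  have h1 : revT A w = w ∘ (revEquiv A).symm := rfl
  rw [h1, dotProduct_comp_equiv_symm]
  have h2 : coef A g ∘ (revEquiv A) = coef A (g.1, -g.2) := by
    funext ψ; exact coef_rev A g ψ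
  rw [h2]
  exact hw _

/-- `revT` preserves `hodge A`. [folklore] -/
theorem revT_mem_hodge {w : Ty A → ℤ} (hw : w ∈ hodge A) : revT A w ∈ hodge A := fun g => revT_mem A hw g

/-- **The `0`-marginal of an `h`-translate is the `h`-translate of the `0`-marginal.** [folklore] -/
theorem marg₀_translH (g : ZMod 2 × A) (v : Ty₂ A → ℤ) : marg₀ A (translH A g v) = transl A g (marg₀ A v) := by
  funext ψ₀
  rw [marg₀_apply]
  show ∑ ψ₁ : Ty A, v (twH A (-g) (ψ₀, ψ₁)) = ∑ ψ₁ : Ty A, v (tw A (-g) ψ₀, ψ₁)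
  exact Fintype.sum_equiv (twEquiv A (-g)) _ _ fun ψ₁ => rfl

/-- **The `1`-marginal of an `h`-translate is the `h`-translate of the `1`-marginal.** [folklore] -/
theorem marg₁_translH (g : ZMod 2 × A) (v : Ty₂ A → ℤ) : marg₁ A (translH A g v) = transl A g (marg₁ A v) := by
  funext ψ₁
  rw [marg₁_apply]
  show ∑ ψ₀ : Ty A, v (twH A (-g) (ψ₀, ψ₁)) = ∑ ψ₀ : Ty A, v (ψ₀, tw A (-g) ψ₁)
  exact Fintype.sum_equiv (twEquiv A (-g)) _ _ fun ψ₀ => rfl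

/-- **The `0`-marginal of the `x`-translate is the reversed `1`-marginal.** [folklore] -/
theorem marg₀_translX (v : Ty₂ A → ℤ) : marg₀ A (translX A v) = revT A (marg₁ A v) := by
  funext α
  rw [marg₀_apply]
  show ∑ β : Ty A, v (twXinv A (α, β)) = ∑ ψ₀ : Ty A, v (ψ₀, rev A α)
  simp only [twXinv]
  refine Fintype.sum_equiv ((revEquiv A).trans (Equiv.addRight (1 : Ty A))) _ _ fun β => ?_
  rfl

/-- **The `1`-marginal of the `x`-translate is the reversed conjugated `0`-marginal.** [folklore] -/
theorem marg₁_translX (v : Ty₂ A → ℤ) : marg₁ A (translX A v) = revT A (transl A (1, 0) (marg₀ A v)) := by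
  funext β
  rw [marg₁_apply]
  have hneg : -((1 : ZMod 2), (0 : A)) = (1, 0) := by ext <;> simp
  show ∑ α : Ty A, v (twXinv A (α, β)) = ∑ ψ₁ : Ty A, v (tw A (-(1, 0)) (rev A β), ψ₁)
  rw [hneg, tw_one_zero]
  simp only [twXinv]
  exact Fintype.sum_equiv (revEquiv A) _ _ fun α => rfl

/-- **`H₂` is stable under the diagonal motions.** [folklore] -/
theorem translH_mem {v : Ty₂ A → ℤ} (hv : v ∈ hodge₂ A) (g : ZMod 2 × A) : translH A g v ∈ hodge₂ A := by
  rw [mem_hodge₂_iff] at hv ⊢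
  rw [marg₀_translH, marg₁_translH]
  exact ⟨transl_mem A hv.1 g, transl_mem A hv.2 g⟩

/-- **`H₂` is stable under the swap-twist.** [folklore] -/
theorem translX_mem {v : Ty₂ A → ℤ} (hv : v ∈ hodge₂ A) : translX A v ∈ hodge₂ A := by
  rw [mem_hodge₂_iff] at hv ⊢
  rw [marg₀_translX, marg₁_translX]
  exact ⟨revT_mem_hodge A hv.2, revT_mem_hodge A (transl_mem A hv.1 _)⟩

end Lattice

end Summit.HodgeConjecture.CorCM.Census.DicyclicTwist
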